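import Summits.QuantumFields.YangMills.Theorems.BalabanUVNodesN06AtOpsYOfLettersAllPins
import Literature.MathematicalPhysics.QuantumFieldTheory.Balaban1983to89.Node00.OpsYDeltaA
import Summits.QuantumFields.YangMills.Theorems.BalabanUVNodesN06SectBOfFrame
import Literature.MathematicalPhysics.QuantumFieldTheory.Balaban1983to89.B9RWSumsDefinitePins
import Literature.MathematicalPhysics.QuantumFieldTheory.Balaban1983to89.B9Thm314Thm315RecordVacuity
import Literature.MathematicalPhysics.QuantumFieldTheory.Balaban1983to89.B9Thm312WholeLeafCoGlob
import Literature.MathematicalPhysics.QuantumFieldTheory.Balaban1983to89.B9Thm313WholeLeafCoGlob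
import Literature.MathematicalPhysics.QuantumFieldTheory.Balaban1983to89.B9Thm312WholeFacesY
import Summits.QuantumFields.YangMills.Theorems.BalabanUVNodesN06AtRecord11ObligationsPins8
import Literature.MathematicalPhysics.QuantumFieldTheory.Balaban1983to89.B9Ineq343GpAtLetters
import Literature.MathematicalPhysics.QuantumFieldTheory.Balaban1983to89.B9Thm39WholeBlkVia
import Literature.MathematicalPhysics.QuantumFieldTheory.Balaban1983to89.B9Ineq347GAAtLetters
import Literature.MathematicalPhysics.QuantumFieldTheory.Balaban1983to89.B9Thm314WholePairWalks
import Literature.MathematicalPhysics.QuantumFieldTheory.Balaban1983to89.B9Thm314WholePinGeometry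

/-!
# BalabanUVNodes ∕ N06 ([B9], `Dag.B9_main`) — THE STAGE-11 CERTIFICATE AT THE `OpsY` INSTANCE OF RECORD, II: ROWS 18–19 AT n06-k's DEFINITE E-LETTERS (two sign records, no
# constants' relations), ROWS 20–21 ON n06-l's LEFT-DIFFERENTIATED LEAVES WITH (3.47) CO-READINGS, every [4]-Lemma-2.1 input DISCHARGED at the record's geometry

Track A of `YM-PLAN.md` (cell `pub-ymgap`, D-0062), node **N06** = [Balaban1985BackgroundPropagators] Thms 3.1–3.15; seat `pub-ymgap-dag-n06-d` gen 3 = N06-ASSIGNMENT v1 (P3).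
Sequel of `…N06AtOpsYOfRecord` (p487053): the 28-obligation certificate p449575 at `ops := Node00.opsYOfRecord N θ M⋆ 𝔈` (def-Y v2's letters of record; only `𝔈` free), every landed
supplier BY NAME as there (rows 1–12 n06-f∕g∕h; row 13 ONE `SectBFrame` via n06-c's `hB_obligation_of_sectBFrame`; rows 15–16 n06-j g5's block-carrier face READ THROUGH REPRESENTATIVES `t39_hksum_of_pin_rowConst261BlkVia` (`π39`, `hπlen`, `hπdist`, `hrdC : KerReadsLeVia …` — the shape the record's «sites = index bonds» reading can meet); row 17 `t311_of_pin`), with THREE CHANGES.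
(i) ROWS 18–19 (`t37`, `c38`, `t310`, `hsum`) = n06-k g3's `B9RWSumsDefinitePins.rows131819_definite_geo9Y p q hp hq …`: the walk pins are read at the DEFINITE E-letters `E37Y p q (𝔬 x) (rd x) (H x) (ops x).Gp`
∕ `E310Y p q (𝔬310 x) (rd310 x) (H x) (ops x).GA` (all-blocks constants `B1Y ∕ delta1Y ∕ BbetaY ∕ BepsY ∕ BepsbetaY` and exponents `exp261 geo9Y …` CHOSEN inside, `R := 1`), so the two sides'
≈ 45 flat binders of the predecessor — primitive reals with their signs, the (2.61) exponents and their equations, `B₁ δ₁ B(·)` and the ELEVEN constants' relations `hCB hCL hδ₁le hCg hBβ hBL5 hBεP hBεβP hB4P …3` —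
collapse to TWO RECORDS `p q : PinPrims` with `hp : p.OK`, `hq : q.OK`; what stays displayed per side is the walk-pin LETTERS (`𝔬 rd 𝔭 bH κ SH SL SI S2` ∕ `…3`), their static∕locality schemas,
Cor. 3.6's block package `h36` and the seven-leg package `h36H` (POSITED, printed∕located shape), the co-readings of the instance's kernel families (`CoRealizes`, `GlobReads`, `L2Reads`₀₋₅, `H1Reads`,
`InputReads`), the transpose letters and the support counts.  (ii) ROWS 20–21 (`t312`, `t313`) = n06-l g3's `B9Thm312WholeLeafCoGlob.thm312Printed_of_stepDHG` ∕ `B9Thm313WholeLeafCoGlob.thm313Printed_of_stepDG`: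
Theorem 3.12's whole printed leaf with (3.42)₁,₂,₃ AND (3.47)₀,₁,₂ for G, G₁ and the two sup members of (3.133) for H, H₁ PROVED INSIDE, Theorem 3.13's with (3.42)₁,₂,₃ + (3.47)₀,₁,₂ of 𝔊 ((3.153)
differentiated on the left), the (3.47) members read by CO-READINGS `hcoG12 hcoG13 : CoReadsGlob …` (`B9Ineq347CoReading` — NOT the structural `GlobReading`, refutable at `geo9K` per n06-l's ORPHAN-BLOCKS
memo ∕ `B9GlobReadingOrphan`); `hL21` DISCHARGED (`R := 1`, `B9Thm312WholeFacesY.lemma21AboveG_geo9Y`), `hL1 hLle hη hrow` likewise; displayed: `hleft12 : LeftStep …`, `hlettersH12 : LettersH …`,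
`hlettersD13 : Letters313D … (bH13 x)` (+ `hκ13`), co-readings `hco12₁ hcoH12 hco13₁ hcoG12 hcoG13`, and `hres12 ∕ hres13` shrunk to the L² ∕ Hölder members.  (iii) ROWS 22–26 (`t314 t314loc t315 s349 s3132`) at THIS instance are the LOCATED VACUITIES of n06-m g3 ∕ n06-i g4
(`B9Thm314Thm315RecordVacuity.t314∕t314loc_opsYOfRecord_vacuous`, `t315_opsYOfRecord_of_slots` (from the two expansion-letter slots `hG5 hH5` + `0 < δ5` only), `B9RecordDELettersVacuity.s349∕
s3132_opsYOfRecord_vacuous`): def-Y v2's Sect. D∕E letters `Kdiff Ck P349 QGQinv QG1Qinv` are the FLAT `0` placeholders, so those rows HOLD OUTRIGHT BUT VACUOUSLY — NOT Bałaban's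
(3.154)∕(3.187)∕(3.49)∕(3.132) content; the ≈ 45 binders of rows 22–26 (pair expansions, localisation data, walk sets, Thm-3.15 letters, `hdict`, (3.132) inputs) are GONE from this instance's
statement and must come back as GENUINE obligations at def-Y's v3 letters (the generic-`𝔏` certificate `…AllPinsD` keeps them displayed).  HONEST FRAMING.  def-Y v2's letters of record
are GENUINE for the transporters, G′ (Ring.inverse), G, C; the Sect. D∕E letters (rows 20–26) are still FLAT `0` placeholders (their displayed hypotheses are vacuously satisfiable there, n06-m g3
LOCATED).  COUNT-NEUTRAL, NOT a discharge claim: the rows are supplied MODULO the displayed schemas (obligations on def-Y's instance and the walk-pin data, uninhabited here); nothing of [B9] proved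
for Bałaban's operators beyond the suppliers' U = 1 theorems; N06 NOT discharged.  One finite 𝕋⁴ programme at fixed `ε` — NOT ℝ⁴ ∕ OS ∕ mass gap ∕ Clay.  0 `def`, 0 `sorry`.
-/




noncomputable section

namespace Summit.QuantumFields.YangMills.BalabanUVNodes.N06AtOpsYOfRecordB

open Literature.MathematicalPhysics.QuantumFieldTheory.Balaban1983to89
open Literature.MathematicalPhysics.QuantumFieldTheory.Balaban1983to89.T4Continuum (T4Family)
open Literature.MathematicalPhysics.QuantumFieldTheory.Balaban1983to89.DagBinding (WorldP leavesP)
open Literature.MathematicalPhysics.QuantumFieldTheory.Balaban1983to89.Node00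
open Literature.MathematicalPhysics.QuantumFieldTheory.Balaban1983to89.B9PinMembersKLevelV1 (MemberY geo9Y bg9Y)
open Literature.MathematicalPhysics.QuantumFieldTheory.Balaban1983to89.B9PinGeometryKLevelV1 (c35Y c35Y_pos)
open Literature.MathematicalPhysics.QuantumFieldTheory.Balaban1983to89.B9Ineq347GAAtLetters (hGA_opsYOfLetters)
open Literature.MathematicalPhysics.QuantumFieldTheory.Balaban1983to89.B7Prop2SpecialUnitary (specialUnitaryUnits)
open Literature.MathematicalPhysics.QuantumFieldTheory.Balaban1983to89.B9Thm37Whole (Ops Sizes StaticOK Local342 Identities)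
open Literature.MathematicalPhysics.QuantumFieldTheory.Balaban1983to89.B9Cor38Whole (WalkReading Locality)
open Literature.MathematicalPhysics.QuantumFieldTheory.Balaban1983to89.B9Thm37GlueCor36 (CoRealizes)
open Literature.MathematicalPhysics.QuantumFieldTheory.Balaban1983to89.B9Thm34Ext (toB6)
open Literature.MathematicalPhysics.QuantumFieldTheory.Balaban1983to89.B9SectBGStepAtLettersMore (SectBFrame)
open Summit.QuantumFields.YangMills.BalabanUVNodes.N06SectBOfFrame (hB_obligation_of_sectBFrame)
open Literature.MathematicalPhysics.QuantumFieldTheory.Balaban1983to89.B9RWSumsDefinitePins (PinPrims E37Y E310Y rows131819_definite_geo9Y)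
open Literature.MathematicalPhysics.QuantumFieldTheory.Balaban1983to89.B9Thm314Thm315RecordVacuity (t314_opsYOfRecord_vacuous t314loc_opsYOfRecord_vacuous t315_opsYOfRecord_of_slots)
open Literature.MathematicalPhysics.QuantumFieldTheory.Balaban1983to89.B9RecordDELettersVacuity (s349_opsYOfRecord_vacuous s3132_opsYOfRecord_vacuous)
open Literature.MathematicalPhysics.QuantumFieldTheory.Balaban1983to89.B9ResidualEntriesAtOne (AtOneL2nOn AtOneE4On AtOneH2On)
open Literature.MathematicalPhysics.QuantumFieldTheory.Balaban1983to89.B9Thm39Whole (WalkReading39)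
open Literature.MathematicalPhysics.QuantumFieldTheory.Balaban1983to89.B9Thm311Whole (Ops311 PosDefOfOps Inputs311)
open Literature.MathematicalPhysics.QuantumFieldTheory.Balaban1983to89.B9Thm310Whole (Ops310 WalkReading310 Sizes310 StaticOK310 Locality310 Local342G Identities310)
open Literature.MathematicalPhysics.QuantumFieldTheory.Balaban1983to89.B9GeoLemma21KLevelV1 (distOK_geo9Y rowSum261_geo9Y geo9Y_dist_triangle geo9Y_dist_comm geo9Y_len_pos)
open Literature.MathematicalPhysics.QuantumFieldTheory.Balaban1983to89.B9GeoNormsKLevelModelSignsV1 (modelSignsOn_geo9K)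
open Summit.QuantumFields.YangMills.BalabanUVNodes.N06AtRecord11ObligationsPins (t311_of_pin)
open Literature.MathematicalPhysics.QuantumFieldTheory.Balaban1983to89.B9Cor35ComparisonsGAAtLetters
  (hGA_e_opsYOfLetters hGA_h1_opsYOfLetters hGA_e4_opsYOfLetters hGA_h2_opsYOfLetters hGA_l2_opsYOfLetters)
open Literature.MathematicalPhysics.QuantumFieldTheory.Balaban1983to89.B9Cor35ComparisonsGpCAtLetters (hGp_e_opsYOfLetters hGp_h1_opsYOfLetters hC_opsYOfLetters)
open Literature.MathematicalPhysics.QuantumFieldTheory.Balaban1983to89.B9RowSum261DefiniteFaces (rowConst261)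
open Literature.MathematicalPhysics.QuantumFieldTheory.Balaban1983to89.B9Thm39WholeBlk (Ops39Blk StaticOK39Blk Locality39Blk Local348Blk Identities395Blk Small285Blk Factors389Blk EK39OfOpsBlk)
open Literature.MathematicalPhysics.QuantumFieldTheory.Balaban1983to89.B9Thm39WholeBlkVia (KerReadsLeVia t39_hksum_of_pin_rowConst261BlkVia)
open Literature.MathematicalPhysics.QuantumFieldTheory.Balaban1983to89.B9Thm312Whole (GeoOK Thm33G0 FormSmall HasRWExpOfOps HasRWExpHOfOps PosDefKOfOps)
open Literature.MathematicalPhysics.QuantumFieldTheory.Balaban1983to89.B11SectG (RowSum)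
open Literature.MathematicalPhysics.QuantumFieldTheory.Balaban1983to89.B9FromB6 (L2Block)
open Literature.MathematicalPhysics.QuantumFieldTheory.Balaban1983to89.B9Thm312WholeLeafCoGlob (thm312Printed_of_stepDHG)
open Literature.MathematicalPhysics.QuantumFieldTheory.Balaban1983to89.B9Thm312WholeH (CoRealizesH LettersH)
open Literature.MathematicalPhysics.QuantumFieldTheory.Balaban1983to89.B9Thm312WholeLeft (LeftStep)
open Literature.MathematicalPhysics.QuantumFieldTheory.Balaban1983to89.B9Thm313WholeLeft (Letters313D)
open Literature.MathematicalPhysics.QuantumFieldTheory.Balaban1983to89.B9Thm313WholeLeafCoGlob (thm313Printed_of_stepDG)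
open Literature.MathematicalPhysics.QuantumFieldTheory.Balaban1983to89.B9Ineq347CoReading (CoReadsGlob)
open Literature.MathematicalPhysics.QuantumFieldTheory.Balaban1983to89.B9Thm312WholeFacesY (lemma21AboveG_geo9Y)
open Literature.MathematicalPhysics.QuantumFieldTheory.Balaban1983to89.B9Thm313Whole (Letters313)
open Literature.MathematicalPhysics.QuantumFieldTheory.Balaban1983to89.B9GeoNormsKLevelV1 (geo9K_dist_nonneg)
open Literature.MathematicalPhysics.QuantumFieldTheory.Balaban1983to89.B9Thm37Glue (IsTransposePair)
open Literature.MathematicalPhysics.QuantumFieldTheory.Balaban1983to89.B9RWSums343to347Whole (GlobReads)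
open Literature.MathematicalPhysics.QuantumFieldTheory.Balaban1983to89.B9RWSums346Schur (L2Reads)
open Literature.MathematicalPhysics.QuantumFieldTheory.Balaban1983to89.B9Cor35ComparisonsEH (hE4_of_hGA_e4 hH2_of_hGA_h2)
open Summit.QuantumFields.YangMills.BalabanUVNodes.N06AtRecord11ObligationsHg (hg_obligation_vacuous)
open Literature.MathematicalPhysics.QuantumFieldTheory.Balaban1983to89.B9RWSums346Two (L2TwoLegs310 FactorsL2_310)
open Literature.MathematicalPhysics.QuantumFieldTheory.Balaban1983to89.B9RWSums346TwoGp (L2TwoLegs37 FactorsL2_37)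
open Literature.MathematicalPhysics.QuantumFieldTheory.Balaban1983to89.B9RWSums344Input (InputReads InputLegs310 FactorsInput310)
open Literature.MathematicalPhysics.QuantumFieldTheory.Balaban1983to89.B9RWSums344InputGp (InputLegs37 FactorsInput37)
open Literature.MathematicalPhysics.QuantumFieldTheory.Balaban1983to89.B11SectG (BlockNorm)
open Literature.MathematicalPhysics.QuantumFieldTheory.Balaban1983to89.B9RWSums343Holder (HolderProbes H1Reads HolderLegs310 FactorsHolder310)
open Literature.MathematicalPhysics.QuantumFieldTheory.Balaban1983to89.B9RWSums343HolderGp (HolderLegs37 HolderV37)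
open Literature.MathematicalPhysics.QuantumFieldTheory.Balaban1983to89.B9RWSums346Lap (LapLegs310 LapLegs37)
open Literature.MathematicalPhysics.QuantumFieldTheory.Balaban1983to89.B9Ineq343GpAtLetters (hGp_opsYOfLetters_of_leaves5)
open Summit.QuantumFields.YangMills.BalabanUVNodes.N06AtRecord11CB10YZW (b9_main_of_up_view₁₁B10YZW_of_obligations)
open scoped Matrix.Norms.L2Operator

variable {N : ℕ}

section Pointed

variable [NeZero N] {F : T4Family}

/-- **THE STAGE-11 CERTIFICATE AT THE `OpsY` INSTANCE OF RECORD, II** (module docstring): `Dag.B9_main` at every run of a world bound over the four-pin Stage-11 view of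
`(θ, M⋆, Node00.opsYOfRecord N θ M⋆ 𝔈, ζ, λ_W)`, every `𝔈`; as `…_opsYOfRecord` but rows 18–19 at n06-k's definite E-letters (two `PinPrims` records) and rows 20–21 on n06-l's
left-differentiated leaves with (3.47) co-readings.  NOT a discharge of N06. [cite: Balaban1985BackgroundPropagators, Thms 3.1–3.15 pp.397–432, Thm 3.7 p.409, Cor. 3.8 p.410, Thm 3.10
pp.414–416, Thms 3.12–3.13 (3.130)–(3.153) pp.422–426, (3.39)–(3.48) pp.397–398, Sect. B pp.400–407, Thm 3.14 p.427; Balaban1984PropagatorsII, (2.51)–(2.52) p.232, Lemma 2.1 (2.60)–(2.61) pp.233–234] -/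
theorem b9_main_of_up_view₁₁B10YZW_opsYOfRecord_coGlob
    (θ : Stage11Params F N) (hθ : θ.Admissible) (Mstar : ℕ) (𝔈 : ExpsY N θ.toStage3Params Mstar) (ζ : ResidZ F N) (lamW : ResidW F N) (w : WorldP) (hup : ∀ P, w.up P = upOfRecord₅C F N (θ.view₁₁B10YZW F N Mstar (opsYOfRecord N θ.toStage3Params Mstar 𝔈) ζ lamW) P)
    [∀ x : MemberY θ.d₆ θ.ℓ₆ θ.hd' θ.hL' θ.b₀ θ.b₁ Mstar, Fintype (geo9Y x).Site] [∀ x : MemberY θ.d₆ θ.ℓ₆ θ.hd' θ.hL' θ.b₀ θ.b₁ Mstar, DecidableEq (geo9Y x).Site] {ιB κB : Type} [Fintype ιB] [DecidableEq ιB] [Fintype κB] [LinearOrder κB] (bB : Module.Basis ιB ℝ (Matrix (Fin N) (Fin N) ℂ))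
    (SB : MemberY θ.d₆ θ.ℓ₆ θ.hd' θ.hL' θ.b₀ θ.b₁ Mstar → Type) [∀ x, Fintype (SB x)] [∀ x, DecidableEq (SB x)] [∀ x : MemberY θ.d₆ θ.ℓ₆ θ.hd' θ.hL' θ.b₀ θ.b₁ Mstar, Nonempty (geo9Y x).Site]
    (F : SectBFrame c35Y geo9Y (bg9Y (Matrix (Fin N) (Fin N) ℂ) (specialUnitaryUnits (Fin N))) (fun x => ((opsYOfRecord N θ.toStage3Params Mstar 𝔈) x).Gp) bB κB SB (fun x => ((opsYOfRecord N θ.toStage3Params Mstar 𝔈) x).GA) (fun x => ((opsYOfRecord N θ.toStage3Params Mstar 𝔈) x).Cinv)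
      (fun x => ((opsYOfRecord N θ.toStage3Params Mstar 𝔈) x).IsAnalyticExt)) (hdB : F.dB = θ.d₆ + 1) {X Y ι PX PY : MemberY θ.d₆ θ.ℓ₆ θ.hd' θ.hL' θ.b₀ θ.b₁ Mstar → Type} [∀ x, Fintype (X x)] [∀ x, DecidableEq (X x)] [∀ x, Fintype (Y x)] [∀ x, DecidableEq (Y x)] [∀ x, Fintype (ι x)]
    [∀ x, Fintype (PX x)] [∀ x, DecidableEq (PX x)] [∀ x, Fintype (PY x)] [∀ x, DecidableEq (PY x)] (hGpL3 : AtOneL2nOn geo9Y (bg9Y (Matrix (Fin N) (Fin N) ℂ) (specialUnitaryUnits (Fin N))) (fun x => ((opsYOfRecord N θ.toStage3Params Mstar 𝔈) x).Gp) (fun _ lam => ¬ (lam.isRight = true)) 3)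
    (hGpL4 : AtOneL2nOn geo9Y (bg9Y (Matrix (Fin N) (Fin N) ℂ) (specialUnitaryUnits (Fin N))) (fun x => ((opsYOfRecord N θ.toStage3Params Mstar 𝔈) x).Gp) (fun _ lam => ¬ (lam.isRight = true)) 4)
    (hGpL5 : AtOneL2nOn geo9Y (bg9Y (Matrix (Fin N) (Fin N) ℂ) (specialUnitaryUnits (Fin N))) (fun x => ((opsYOfRecord N θ.toStage3Params Mstar 𝔈) x).Gp) (fun _ lam => ¬ (lam.isRight = true)) 5)
    (hGpE4 : AtOneE4On geo9Y (bg9Y (Matrix (Fin N) (Fin N) ℂ) (specialUnitaryUnits (Fin N))) (fun x => ((opsYOfRecord N θ.toStage3Params Mstar 𝔈) x).Gp) (fun _ lam => ¬ (lam.isRight = true)))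
    (hGpH2 : AtOneH2On geo9Y (bg9Y (Matrix (Fin N) (Fin N) ℂ) (specialUnitaryUnits (Fin N))) (fun x => ((opsYOfRecord N θ.toStage3Params Mstar 𝔈) x).Gp) (fun _ lam => ¬ (lam.isRight = true))) {X39 ι39 κ39 : MemberY θ.d₆ θ.ℓ₆ θ.hd' θ.hL' θ.b₀ θ.b₁ Mstar → Type} [∀ x, Fintype (ι39 x)]
    [∀ x, Fintype (X39 x)] [∀ x, DecidableEq (X39 x)] (𝔬39 : ∀ x : MemberY θ.d₆ θ.ℓ₆ θ.hd' θ.hL' θ.b₀ θ.b₁ Mstar, Ops39Blk (geo9Y x) (bg9Y (Matrix (Fin N) (Fin N) ℂ) (specialUnitaryUnits (Fin N)) x) (X39 x) (ι39 x) (κ39 x))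
    (rd39 : ∀ x : MemberY θ.d₆ θ.ℓ₆ θ.hd' θ.hL' θ.b₀ θ.b₁ Mstar, WalkReading39 (bg9Y (Matrix (Fin N) (Fin N) ℂ) (specialUnitaryUnits (Fin N)) x) (ι39 x) (κ39 x)) (α39 α' r39 δ39 θ39 B39 N39 a39 M39 cR39 : ℝ) (hcR39 : 0 ≤ cR39) (h39α : 0 < α39) (h39α1 : α39 < 1) (hα'0 : 0 < α') (hα'1 : α' < 1)
    (hr39 : 0 < r39) (hrδ39 : r39 ≤ δ39) (hθ39 : 0 ≤ θ39) (hB39 : 0 < B39) (hN39 : 0 ≤ N39) (ha39 : 0 < a39) (hM39 : 0 < M39) (hst39 : ∀ x, StaticOK39Blk (𝔬39 x) N39) (hloc39 : ∀ x, Locality39Blk (𝔬39 x) (rd39 x))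
    (h39 : ∀ x : MemberY θ.d₆ θ.ℓ₆ θ.hd' θ.hL' θ.b₀ θ.b₁ Mstar, M39 ≤ (geo9Y x).M → ∀ α₀ : ℝ, 0 < α₀ → c35Y * (geo9Y x).M * α₀ ≤ a39 →
      ∀ U : (bg9Y (Matrix (Fin N) (Fin N) ℂ) (specialUnitaryUnits (Fin N)) x).Cfg, (bg9Y (Matrix (Fin N) (Fin N) ℂ) (specialUnitaryUnits (Fin N)) x).Reg335 c35Y α₀ U →
        Local348Blk (𝔬39 x) B39 δ39 U ∧ Identities395Blk (𝔬39 x) U ∧ Small285Blk (𝔬39 x) θ39 r39 U ∧ Factors389Blk (𝔬39 x) θ39 δ39 U) (hEK39 : ∀ x : MemberY θ.d₆ θ.ℓ₆ θ.hd' θ.hL' θ.b₀ θ.b₁ Mstar, ((opsYOfRecord N θ.toStage3Params Mstar 𝔈) x).EK39 = EK39OfOpsBlk (𝔬39 x) (rd39 x) (θ.d₆ + 1)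
      (2 * (N39 * B39) * rowConst261 (geo9Y (d := θ.d₆) (ℓ := θ.ℓ₆) (hd := θ.hd') (hL := θ.hL') (b₀ := θ.b₀) (b₁ := θ.b₁) (Mstar := Mstar)) (α' * r39)) ((1 - α') * r39))
    (π39 : ∀ x : MemberY θ.d₆ θ.ℓ₆ θ.hd' θ.hL' θ.b₀ θ.b₁ Mstar, (geo9Y x).Site → (geo9Y x).Site) (hπlen : ∀ (x : MemberY θ.d₆ θ.ℓ₆ θ.hd' θ.hL' θ.b₀ θ.b₁ Mstar) (y : (geo9Y x).Site), (geo9Y x).len (π39 x y) = (geo9Y x).len y)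
    (hπdist : ∀ (x : MemberY θ.d₆ θ.ℓ₆ θ.hd' θ.hL' θ.b₀ θ.b₁ Mstar) (y y' : (geo9Y x).Site), (geo9Y x).dist (π39 x y) (π39 x y') = (geo9Y x).dist y y')
    (hrdC : ∀ x : MemberY θ.d₆ θ.ℓ₆ θ.hd' θ.hL' θ.b₀ θ.b₁ Mstar, KerReadsLeVia (𝔬39 x) ((opsYOfRecord N θ.toStage3Params Mstar 𝔈) x).Cinv (θ.d₆ + 1) cR39 (π39 x))
    {δ5 : ℝ} (hδ5 : 0 < δ5) (hG5 : ∀ (x : MemberY θ.d₆ θ.ℓ₆ θ.hd' θ.hL' θ.b₀ θ.b₁ Mstar) (U : (bg9Y (Matrix (Fin N) (Fin N) ℂ) (specialUnitaryUnits (Fin N)) x).Cfg), ((opsYOfRecord N θ.toStage3Params Mstar 𝔈) x).GivenBy3185 U)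
    (hH5 : ∀ (x : MemberY θ.d₆ θ.ℓ₆ θ.hd' θ.hL' θ.b₀ θ.b₁ Mstar) (U : (bg9Y (Matrix (Fin N) (Fin N) ℂ) (specialUnitaryUnits (Fin N)) x).Cfg), ((opsYOfRecord N θ.toStage3Params Mstar 𝔈) x).HasRWExpC U δ5) (p q : PinPrims) (hp : p.OK) (hq : q.OK)
    (H : MemberY θ.d₆ θ.ℓ₆ θ.hd' θ.hL' θ.b₀ θ.b₁ Mstar → Prop) (𝔬 : ∀ x, Ops (geo9Y x) (bg9Y (Matrix (Fin N) (Fin N) ℂ) (specialUnitaryUnits (Fin N)) x) (X x) (Y x) (ι x)) (rd : ∀ x, WalkReading (geo9Y x) (bg9Y (Matrix (Fin N) (Fin N) ℂ) (specialUnitaryUnits (Fin N)) x) (X x) (ι x))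
    (𝔭 : ∀ x : MemberY θ.d₆ θ.ℓ₆ θ.hd' θ.hL' θ.b₀ θ.b₁ Mstar, HolderProbes (geo9Y x) (bg9Y (Matrix (Fin N) (Fin N) ℂ) (specialUnitaryUnits (Fin N)) x) (X x) (Y x) (PX x) (PY x)) (bH : ∀ x : MemberY θ.d₆ θ.ℓ₆ θ.hd' θ.hL' θ.b₀ θ.b₁ Mstar, ℝ → BlockNorm (toB6 (geo9Y x) 1 (H x)) (Y x → ℝ))
    (evY : ∀ x : MemberY θ.d₆ θ.ℓ₆ θ.hd' θ.hL' θ.b₀ θ.b₁ Mstar, (geo9Y x).Loc → Y x → ℝ) (κ : MemberY θ.d₆ θ.ℓ₆ θ.hd' θ.hL' θ.b₀ θ.b₁ Mstar → Sizes) (SH SL SI S2 : ∀ x : MemberY θ.d₆ θ.ℓ₆ θ.hd' θ.hL' θ.b₀ θ.b₁ Mstar, ι x → Finset (geo9Y x).Site) (hst : ∀ x, StaticOK (𝔬 x) p.ρ p.Nc p.N' p.Cℓ (κ x))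
    (hκ : ∀ x, (κ x).Bounded p.Kc p.θ₀ p.Cℓ (geo9Y x).M) (hrd : ∀ x, (rd x).OK (𝔬 x).blk) (hloc : ∀ x, Locality (𝔬 x) (rd x))
    (h36 : ∀ x, p.M₁ ≤ (geo9Y x).M → ∀ α₀ : ℝ, 0 < α₀ → c35Y * (geo9Y x).M * α₀ ≤ p.a₁ → ∀ U : (bg9Y (Matrix (Fin N) (Fin N) ℂ) (specialUnitaryUnits (Fin N)) x).Cfg, (bg9Y (Matrix (Fin N) (Fin N) ℂ) (specialUnitaryUnits (Fin N)) x).Reg335 c35Y α₀ U →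
      Local342 (𝔬 x) 1 (H x) p.B₀ p.δ₀ U ∧ Identities (𝔬 x) 1 (H x) U)
    (h36H : ∀ x, p.M₁ ≤ (geo9Y x).M → ∀ α₀ : ℝ, 0 < α₀ → c35Y * (geo9Y x).M * α₀ ≤ p.a₁ → ∀ U : (bg9Y (Matrix (Fin N) (Fin N) ℂ) (specialUnitaryUnits (Fin N)) x).Cfg, (bg9Y (Matrix (Fin N) (Fin N) ℂ) (specialUnitaryUnits (Fin N)) x).Reg335 c35Y α₀ U →
      HolderLegs37 (𝔬 x) (𝔭 x) 1 (H x) (SH x) p.Bl p.δ₀ U ∧ HolderV37 (𝔬 x) (𝔭 x) 1 (H x) p.Bt p.δ₀ U ∧ LapLegs37 (𝔬 x) 1 (H x) (SL x) p.BL p.δ₀ U ∧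
        InputLegs37 (𝔬 x) (𝔭 x) 1 (H x) (bH x) (SI x) p.BI p.BI2 p.δ₀ U ∧ FactorsInput37 (𝔬 x) 1 (H x) (bH x) p.θI p.δ₀ U ∧
          L2TwoLegs37 (𝔬 x) 1 (H x) (S2 x) p.B2 p.δ₀ U ∧ FactorsL2_37 (𝔬 x) 1 (H x) p.θ2 p.δ₀ U) (hco0 : ∀ x U, CoRealizes ((opsYOfRecord N θ.toStage3Params Mstar 𝔈) x).Gp 0 U (𝔬 x).blk (𝔬 x).blk (rd x).ev ((𝔬 x).Gp U))
    (hco1 : ∀ x U, CoRealizes ((opsYOfRecord N θ.toStage3Params Mstar 𝔈) x).Gp 1 U (𝔬 x).blkY (𝔬 x).blk (rd x).ev ((𝔬 x).D U ∘ₗ (𝔬 x).Gp U)) (hco2 : ∀ x U, CoRealizes ((opsYOfRecord N θ.toStage3Params Mstar 𝔈) x).Gp 2 U (𝔬 x).blk (𝔬 x).blkY (evY x) ((𝔬 x).Gp U ∘ₗ (𝔬 x).Dstar U))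
    (hco3 : ∀ x U, CoRealizes ((opsYOfRecord N θ.toStage3Params Mstar 𝔈) x).Gp 3 U (𝔬 x).blk (𝔬 x).blk (rd x).ev ((𝔬 x).Lap U ∘ₗ (𝔬 x).Gp U)) (hgl0 : ∀ x U, GlobReads ((opsYOfRecord N θ.toStage3Params Mstar 𝔈) x).Gp 0 U (𝔬 x).blk (𝔬 x).blk (rd x).ev ((𝔬 x).Gp U))
    (hgl1 : ∀ x U, GlobReads ((opsYOfRecord N θ.toStage3Params Mstar 𝔈) x).Gp 1 U (𝔬 x).blkY (𝔬 x).blk (rd x).ev ((𝔬 x).D U ∘ₗ (𝔬 x).Gp U)) (hgl2 : ∀ x U, GlobReads ((opsYOfRecord N θ.toStage3Params Mstar 𝔈) x).Gp 2 U (𝔬 x).blk (𝔬 x).blkY (evY x) ((𝔬 x).Gp U ∘ₗ (𝔬 x).Dstar U))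
    (hgl3 : ∀ x U, GlobReads ((opsYOfRecord N θ.toStage3Params Mstar 𝔈) x).Gp 3 U (𝔬 x).blk (𝔬 x).blk (rd x).ev ((𝔬 x).Lap U ∘ₗ (𝔬 x).Gp U)) (hl0 : ∀ x U, L2Reads (R := 1) (H := H x) ((opsYOfRecord N θ.toStage3Params Mstar 𝔈) x).Gp 0 U (𝔬 x).blk (𝔬 x).blk (rd x).ev ((𝔬 x).Gp U))
    (hl1 : ∀ x U, L2Reads (R := 1) (H := H x) ((opsYOfRecord N θ.toStage3Params Mstar 𝔈) x).Gp 1 U (𝔬 x).blkY (𝔬 x).blk (rd x).ev ((𝔬 x).D U ∘ₗ (𝔬 x).Gp U))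
    (hl2 : ∀ x U, L2Reads (R := 1) (H := H x) ((opsYOfRecord N θ.toStage3Params Mstar 𝔈) x).Gp 2 U (𝔬 x).blk (𝔬 x).blkY (evY x) ((𝔬 x).Gp U ∘ₗ (𝔬 x).Dstar U))
    (hl3 : ∀ x U, L2Reads (R := 1) (H := H x) ((opsYOfRecord N θ.toStage3Params Mstar 𝔈) x).Gp 3 U (𝔬 x).blk (𝔬 x).blk (rd x).ev ((𝔬 x).Lap U ∘ₗ (𝔬 x).Gp U))
    (hl4 : ∀ x U, L2Reads (R := 1) (H := H x) ((opsYOfRecord N θ.toStage3Params Mstar 𝔈) x).Gp 4 U (𝔬 x).blkY (𝔬 x).blkY (evY x) ((𝔬 x).D U ∘ₗ ((𝔬 x).Gp U ∘ₗ (𝔬 x).Dstar U)))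
    (hl5 : ∀ x U, L2Reads (R := 1) (H := H x) ((opsYOfRecord N θ.toStage3Params Mstar 𝔈) x).Gp 5 U (𝔬 x).blk (𝔬 x).blk (rd x).ev ((𝔬 x).Gp U ∘ₗ (𝔬 x).Lap U))
    (hH1 : ∀ x U, H1Reads ((opsYOfRecord N θ.toStage3Params Mstar 𝔈) x).Gp U (𝔭 x) (𝔬 x).blk (𝔬 x).blkY (rd x).ev (evY x) ((𝔬 x).D U ∘ₗ (𝔬 x).Gp U) ((𝔬 x).Gp U ∘ₗ (𝔬 x).Dstar U))
    (hIR : ∀ x U, InputReads ((opsYOfRecord N θ.toStage3Params Mstar 𝔈) x).Gp U (𝔭 x) (bH x) (𝔬 x).blkY (evY x) ((𝔬 x).D U ∘ₗ ((𝔬 x).Gp U ∘ₗ (𝔬 x).Dstar U))) (hsym : ∀ x U, IsTransposePair ((𝔬 x).Gp U) ((𝔬 x).Gp U))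
    (htr : ∀ x U, IsTransposePair ((𝔬 x).D U ∘ₗ (𝔬 x).Gp U) ((𝔬 x).Gp U ∘ₗ (𝔬 x).Dstar U)) (hadjL : ∀ x U, IsTransposePair ((𝔬 x).Lap U ∘ₗ (𝔬 x).Gp U) ((𝔬 x).Gp U ∘ₗ (𝔬 x).Lap U))
    (hcntH : ∀ (x : MemberY θ.d₆ θ.ℓ₆ θ.hd' θ.hL' θ.b₀ θ.b₁ Mstar) (a : (geo9Y x).Site), (∑ c, if a ∈ SH x c then (1 : ℝ) else 0) ≤ p.NH) (hcntL : ∀ (x : MemberY θ.d₆ θ.ℓ₆ θ.hd' θ.hL' θ.b₀ θ.b₁ Mstar) (a : (geo9Y x).Site), (∑ c, if a ∈ SL x c then (1 : ℝ) else 0) ≤ p.NL)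
    (hcntI : ∀ (x : MemberY θ.d₆ θ.ℓ₆ θ.hd' θ.hL' θ.b₀ θ.b₁ Mstar) (a : (geo9Y x).Site), (∑ c, if a ∈ SI x c then (1 : ℝ) else 0) ≤ p.NI) (hcnt2 : ∀ (x : MemberY θ.d₆ θ.ℓ₆ θ.hd' θ.hL' θ.b₀ θ.b₁ Mstar) (a : (geo9Y x).Site), (∑ c, if a ∈ S2 x c then (1 : ℝ) else 0) ≤ p.N2)
    (hE37 : ∀ x : MemberY θ.d₆ θ.ℓ₆ θ.hd' θ.hL' θ.b₀ θ.b₁ Mstar, ((opsYOfRecord N θ.toStage3Params Mstar 𝔈) x).E37 = E37Y (bg := bg9Y (Matrix (Fin N) (Fin N) ℂ) (specialUnitaryUnits (Fin N))) p q (𝔬 x) (rd x) (H x) ((opsYOfRecord N θ.toStage3Params Mstar 𝔈) x).Gp)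
    {E7 F7 W7 : MemberY θ.d₆ θ.ℓ₆ θ.hd' θ.hL' θ.b₀ θ.b₁ Mstar → Type} [∀ x, NormedAddCommGroup (E7 x)] [∀ x, InnerProductSpace ℝ (E7 x)] [∀ x, NormedAddCommGroup (F7 x)] [∀ x, InnerProductSpace ℝ (F7 x)] [∀ x, NormedAddCommGroup (W7 x)] [∀ x, InnerProductSpace ℝ (W7 x)]
    [∀ x, FiniteDimensional ℝ (W7 x)] (𝔬311 : ∀ x : MemberY θ.d₆ θ.ℓ₆ θ.hd' θ.hL' θ.b₀ θ.b₁ Mstar, Ops311 (bg9Y (Matrix (Fin N) (Fin N) ℂ) (specialUnitaryUnits (Fin N)) x) (E7 x) (F7 x) (W7 x)) (θ311 a311 M311 : ℝ) (ha311 : 0 < a311) (hM311 : 0 < M311)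
    (h311 : ∀ x : MemberY θ.d₆ θ.ℓ₆ θ.hd' θ.hL' θ.b₀ θ.b₁ Mstar, M311 ≤ (geo9Y x).M → ∀ α₀ : ℝ, 0 < α₀ → (geo9Y x).M * α₀ ≤ a311 →
      ∀ U : (bg9Y (Matrix (Fin N) (Fin N) ℂ) (specialUnitaryUnits (Fin N)) x).Cfg, (bg9Y (Matrix (Fin N) (Fin N) ℂ) (specialUnitaryUnits (Fin N)) x).Reg335 c35Y α₀ U → Inputs311 (𝔬311 x) θ311 (geo9Y x).M U)
    (hPD : ∀ x : MemberY θ.d₆ θ.ℓ₆ θ.hd' θ.hL' θ.b₀ θ.b₁ Mstar, ((opsYOfRecord N θ.toStage3Params Mstar 𝔈) x).PosDef = PosDefOfOps (𝔬311 x)) {X3 Y3 ι3 A3 PX3 PY3 : MemberY θ.d₆ θ.ℓ₆ θ.hd' θ.hL' θ.b₀ θ.b₁ Mstar → Type} [∀ x, Fintype (X3 x)] [∀ x, DecidableEq (X3 x)] [∀ x, Fintype (Y3 x)]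
    [∀ x, DecidableEq (Y3 x)] [∀ x, Fintype (ι3 x)] [∀ x, Fintype (A3 x)] [∀ x, Fintype (PX3 x)] [∀ x, DecidableEq (PX3 x)] [∀ x, Fintype (PY3 x)] [∀ x, DecidableEq (PY3 x)]
    (𝔬310 : ∀ x : MemberY θ.d₆ θ.ℓ₆ θ.hd' θ.hL' θ.b₀ θ.b₁ Mstar, Ops310 (geo9Y x) (bg9Y (Matrix (Fin N) (Fin N) ℂ) (specialUnitaryUnits (Fin N)) x) (X3 x) (Y3 x) (ι3 x) (A3 x))
    (rd310 : ∀ x : MemberY θ.d₆ θ.ℓ₆ θ.hd' θ.hL' θ.b₀ θ.b₁ Mstar, WalkReading310 (geo9Y x) (bg9Y (Matrix (Fin N) (Fin N) ℂ) (specialUnitaryUnits (Fin N)) x) (X3 x) (ι3 x) (A3 x))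
    (𝔭3 : ∀ x : MemberY θ.d₆ θ.ℓ₆ θ.hd' θ.hL' θ.b₀ θ.b₁ Mstar, HolderProbes (geo9Y x) (bg9Y (Matrix (Fin N) (Fin N) ℂ) (specialUnitaryUnits (Fin N)) x) (X3 x) (Y3 x) (PX3 x) (PY3 x)) (bH3 : ∀ x : MemberY θ.d₆ θ.ℓ₆ θ.hd' θ.hL' θ.b₀ θ.b₁ Mstar, ℝ → BlockNorm (toB6 (geo9Y x) 1 (H x)) (Y3 x → ℝ))
    (ev3 : ∀ x : MemberY θ.d₆ θ.ℓ₆ θ.hd' θ.hL' θ.b₀ θ.b₁ Mstar, (geo9Y x).Loc → X3 x → ℝ) (evY3 : ∀ x : MemberY θ.d₆ θ.ℓ₆ θ.hd' θ.hL' θ.b₀ θ.b₁ Mstar, (geo9Y x).Loc → Y3 x → ℝ) (κ310 : MemberY θ.d₆ θ.ℓ₆ θ.hd' θ.hL' θ.b₀ θ.b₁ Mstar → Sizes310)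
    (SH3 SL3 SI3 S23 : ∀ x : MemberY θ.d₆ θ.ℓ₆ θ.hd' θ.hL' θ.b₀ θ.b₁ Mstar, ι3 x → Finset (geo9Y x).Site) (hst3 : ∀ x, StaticOK310 (𝔬310 x) q.ρ q.Nc q.N' q.NF q.Cℓ (κ310 x)) (hκ3 : ∀ x, (κ310 x).Bounded q.Kc) (hrd3 : ∀ x, (rd310 x).OK (𝔬310 x).blk) (hloc3 : ∀ x, Locality310 (𝔬310 x) (rd310 x))
    (h36_3 : ∀ x, q.M₁ ≤ (geo9Y x).M → ∀ α₀ : ℝ, 0 < α₀ → c35Y * (geo9Y x).M * α₀ ≤ q.a₁ → ∀ U : (bg9Y (Matrix (Fin N) (Fin N) ℂ) (specialUnitaryUnits (Fin N)) x).Cfg, (bg9Y (Matrix (Fin N) (Fin N) ℂ) (specialUnitaryUnits (Fin N)) x).Reg335 c35Y α₀ U →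
      Local342G (𝔬310 x) 1 (H x) q.B₀ q.δ₀ U ∧ B9Thm310Whole.Factors389 (𝔬310 x) 1 (H x) q.θ₀ q.δ₀ U ∧ Identities310 (𝔬310 x) 1 (H x) U)
    (h36H3 : ∀ x, q.M₁ ≤ (geo9Y x).M → ∀ α₀ : ℝ, 0 < α₀ → c35Y * (geo9Y x).M * α₀ ≤ q.a₁ → ∀ U : (bg9Y (Matrix (Fin N) (Fin N) ℂ) (specialUnitaryUnits (Fin N)) x).Cfg, (bg9Y (Matrix (Fin N) (Fin N) ℂ) (specialUnitaryUnits (Fin N)) x).Reg335 c35Y α₀ U →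
      HolderLegs310 (𝔬310 x) (𝔭3 x) 1 (H x) (SH3 x) q.Bl q.δ₀ U ∧ FactorsHolder310 (𝔬310 x) (𝔭3 x) 1 (H x) q.Bt q.δ₀ U ∧ LapLegs310 (𝔬310 x) 1 (H x) (SL3 x) q.BL q.δ₀ U ∧
        InputLegs310 (𝔬310 x) (𝔭3 x) 1 (H x) (bH3 x) (SI3 x) q.BI q.BI2 q.δ₀ U ∧ FactorsInput310 (𝔬310 x) 1 (H x) (bH3 x) q.θI q.δ₀ U ∧
          L2TwoLegs310 (𝔬310 x) 1 (H x) (S23 x) q.B2 q.δ₀ U ∧ FactorsL2_310 (𝔬310 x) 1 (H x) q.θ2 q.δ₀ U) (hcoA0 : ∀ x U, CoRealizes ((opsYOfRecord N θ.toStage3Params Mstar 𝔈) x).GA 0 U (𝔬310 x).blk (𝔬310 x).blk (ev3 x) ((𝔬310 x).G U))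
    (hcoA1 : ∀ x U, CoRealizes ((opsYOfRecord N θ.toStage3Params Mstar 𝔈) x).GA 1 U (𝔬310 x).blkY (𝔬310 x).blk (ev3 x) ((𝔬310 x).D U ∘ₗ (𝔬310 x).G U))
    (hcoA2 : ∀ x U, CoRealizes ((opsYOfRecord N θ.toStage3Params Mstar 𝔈) x).GA 2 U (𝔬310 x).blk (𝔬310 x).blkY (evY3 x) ((𝔬310 x).G U ∘ₗ (𝔬310 x).Dstar U))
    (hcoA3 : ∀ x U, CoRealizes ((opsYOfRecord N θ.toStage3Params Mstar 𝔈) x).GA 3 U (𝔬310 x).blk (𝔬310 x).blk (ev3 x) ((𝔬310 x).Lap U ∘ₗ (𝔬310 x).G U)) (hglA0 : ∀ x U, GlobReads ((opsYOfRecord N θ.toStage3Params Mstar 𝔈) x).GA 0 U (𝔬310 x).blk (𝔬310 x).blk (ev3 x) ((𝔬310 x).G U))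
    (hglA1 : ∀ x U, GlobReads ((opsYOfRecord N θ.toStage3Params Mstar 𝔈) x).GA 1 U (𝔬310 x).blkY (𝔬310 x).blk (ev3 x) ((𝔬310 x).D U ∘ₗ (𝔬310 x).G U)) (hglA2 : ∀ x U, GlobReads ((opsYOfRecord N θ.toStage3Params Mstar 𝔈) x).GA 2 U (𝔬310 x).blk (𝔬310 x).blkY (evY3 x) ((𝔬310 x).G U ∘ₗ (𝔬310 x).Dstar U))
    (hglA3 : ∀ x U, GlobReads ((opsYOfRecord N θ.toStage3Params Mstar 𝔈) x).GA 3 U (𝔬310 x).blk (𝔬310 x).blk (ev3 x) ((𝔬310 x).Lap U ∘ₗ (𝔬310 x).G U)) (hlA0 : ∀ x U, L2Reads (R := 1) (H := H x) ((opsYOfRecord N θ.toStage3Params Mstar 𝔈) x).GA 0 U (𝔬310 x).blk (𝔬310 x).blk (ev3 x) ((𝔬310 x).G U))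
    (hlA1 : ∀ x U, L2Reads (R := 1) (H := H x) ((opsYOfRecord N θ.toStage3Params Mstar 𝔈) x).GA 1 U (𝔬310 x).blkY (𝔬310 x).blk (ev3 x) ((𝔬310 x).D U ∘ₗ (𝔬310 x).G U))
    (hlA2 : ∀ x U, L2Reads (R := 1) (H := H x) ((opsYOfRecord N θ.toStage3Params Mstar 𝔈) x).GA 2 U (𝔬310 x).blk (𝔬310 x).blkY (evY3 x) ((𝔬310 x).G U ∘ₗ (𝔬310 x).Dstar U))
    (hlA3 : ∀ x U, L2Reads (R := 1) (H := H x) ((opsYOfRecord N θ.toStage3Params Mstar 𝔈) x).GA 3 U (𝔬310 x).blk (𝔬310 x).blk (ev3 x) ((𝔬310 x).Lap U ∘ₗ (𝔬310 x).G U))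
    (hlA4 : ∀ x U, L2Reads (R := 1) (H := H x) ((opsYOfRecord N θ.toStage3Params Mstar 𝔈) x).GA 4 U (𝔬310 x).blkY (𝔬310 x).blkY (evY3 x) ((𝔬310 x).D U ∘ₗ ((𝔬310 x).G U ∘ₗ (𝔬310 x).Dstar U)))
    (hlA5 : ∀ x U, L2Reads (R := 1) (H := H x) ((opsYOfRecord N θ.toStage3Params Mstar 𝔈) x).GA 5 U (𝔬310 x).blk (𝔬310 x).blk (ev3 x) ((𝔬310 x).G U ∘ₗ (𝔬310 x).Lap U))
    (hH13 : ∀ x U, H1Reads ((opsYOfRecord N θ.toStage3Params Mstar 𝔈) x).GA U (𝔭3 x) (𝔬310 x).blk (𝔬310 x).blkY (ev3 x) (evY3 x) ((𝔬310 x).D U ∘ₗ (𝔬310 x).G U) ((𝔬310 x).G U ∘ₗ (𝔬310 x).Dstar U))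
    (hIR3 : ∀ x U, InputReads ((opsYOfRecord N θ.toStage3Params Mstar 𝔈) x).GA U (𝔭3 x) (bH3 x) (𝔬310 x).blkY (evY3 x) ((𝔬310 x).D U ∘ₗ ((𝔬310 x).G U ∘ₗ (𝔬310 x).Dstar U))) (hsymA : ∀ x U, IsTransposePair ((𝔬310 x).G U) ((𝔬310 x).G U))
    (htrA : ∀ x U, IsTransposePair ((𝔬310 x).D U ∘ₗ (𝔬310 x).G U) ((𝔬310 x).G U ∘ₗ (𝔬310 x).Dstar U)) (hadjLA : ∀ x U, IsTransposePair ((𝔬310 x).Lap U ∘ₗ (𝔬310 x).G U) ((𝔬310 x).G U ∘ₗ (𝔬310 x).Lap U))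
    (hcntH3 : ∀ (x : MemberY θ.d₆ θ.ℓ₆ θ.hd' θ.hL' θ.b₀ θ.b₁ Mstar) (a : (geo9Y x).Site), (∑ c, if a ∈ SH3 x c then (1 : ℝ) else 0) ≤ q.NH) (hcntL3 : ∀ (x : MemberY θ.d₆ θ.ℓ₆ θ.hd' θ.hL' θ.b₀ θ.b₁ Mstar) (a : (geo9Y x).Site), (∑ c, if a ∈ SL3 x c then (1 : ℝ) else 0) ≤ q.NL)
    (hcntI3 : ∀ (x : MemberY θ.d₆ θ.ℓ₆ θ.hd' θ.hL' θ.b₀ θ.b₁ Mstar) (a : (geo9Y x).Site), (∑ c, if a ∈ SI3 x c then (1 : ℝ) else 0) ≤ q.NI) (hcnt23 : ∀ (x : MemberY θ.d₆ θ.ℓ₆ θ.hd' θ.hL' θ.b₀ θ.b₁ Mstar) (a : (geo9Y x).Site), (∑ c, if a ∈ S23 x c then (1 : ℝ) else 0) ≤ q.N2)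
    (hE310 : ∀ x : MemberY θ.d₆ θ.ℓ₆ θ.hd' θ.hL' θ.b₀ θ.b₁ Mstar, ((opsYOfRecord N θ.toStage3Params Mstar 𝔈) x).E310 = E310Y (bg := bg9Y (Matrix (Fin N) (Fin N) ℂ) (specialUnitaryUnits (Fin N))) p q (𝔬310 x) (rd310 x) (H x) ((opsYOfRecord N θ.toStage3Params Mstar 𝔈) x).GA)
    {X12 Y12 Z12 W12 : MemberY θ.d₆ θ.ℓ₆ θ.hd' θ.hL' θ.b₀ θ.b₁ Mstar → Type} [∀ x, Fintype (X12 x)] [∀ x, DecidableEq (X12 x)] [∀ x, Fintype (Y12 x)] [∀ x, Fintype (Z12 x)] [∀ x, Fintype (W12 x)]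
    (𝔬12 : ∀ x : MemberY θ.d₆ θ.ℓ₆ θ.hd' θ.hL' θ.b₀ θ.b₁ Mstar, B9Thm312Whole.Ops (geo9Y x) (bg9Y (Matrix (Fin N) (Fin N) ℂ) (specialUnitaryUnits (Fin N)) x) (X12 x) (Y12 x) (Z12 x) (W12 x)) (H12 : MemberY θ.d₆ θ.ℓ₆ θ.hd' θ.hL' θ.b₀ θ.b₁ Mstar → Prop)
    (ev12 : ∀ x : MemberY θ.d₆ θ.ℓ₆ θ.hd' θ.hL' θ.b₀ θ.b₁ Mstar, (geo9Y x).Loc → X12 x → ℝ) (evY12 : ∀ x : MemberY θ.d₆ θ.ℓ₆ θ.hd' θ.hL' θ.b₀ θ.b₁ Mstar, (geo9Y x).Loc → Y12 x → ℝ) (bH13 : ∀ x : MemberY θ.d₆ θ.ℓ₆ θ.hd' θ.hL' θ.b₀ θ.b₁ Mstar, BlockNorm (toB6 (geo9Y x) 1 (H12 x)) (W12 x → ℝ))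
    (θ12 θD12 r12 B12₀ δ12₀ δK12 σ12 ρ12 a12 M12 B12₁ δ12₁ B12₃ δ12₃ ρ13 α12 κ13 : ℝ) (Bβ12 Bε12 : ℝ → ℝ) (Bεβ12 : ℝ → ℝ → ℝ) (hθ12 : 0 ≤ θ12) (hθD12 : 0 ≤ θD12) (hr12 : 0 ≤ r12) (hB12₀ : 0 ≤ B12₀) (hB12₃ : 0 ≤ B12₃) (hσ12 : 0 < σ12) (hρ12 : 0 < ρ12) (hρS12 : ρ12 ≤ δ12₀) (hρδ12 : ρ12 + σ12 ≤ δK12)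
    (hρ₃12 : ρ12 + σ12 ≤ δ12₃) (ha12 : 0 < a12) (hM12 : 0 < M12) (hδ12₁ : 0 < δ12₁) (hα12 : 0 < α12) (hα12' : α12 ≤ 1 / 2) (hBβ12 : ∀ β, 0 ≤ Bβ12 β) (hBε12 : ∀ ε, 0 ≤ Bε12 ε) (hBεβ12 : ∀ ε β, 0 ≤ Bεβ12 ε β) (hκ13 : ∀ x, (bH13 x).κ ≤ κ13) (hρ13 : 0 < ρ13) (hρ13ρ : ρ13 + 3 * σ12 ≤ ρ12)
    (hco12 : ∀ (x : MemberY θ.d₆ θ.ℓ₆ θ.hd' θ.hL' θ.b₀ θ.b₁ Mstar) (U : (bg9Y (Matrix (Fin N) (Fin N) ℂ) (specialUnitaryUnits (Fin N)) x).Cfg),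
      CoRealizes ((opsYOfRecord N θ.toStage3Params Mstar 𝔈) x).GD 0 U (𝔬12 x).blk (𝔬12 x).blk (ev12 x) ((𝔬12 x).G U) ∧ CoRealizes ((opsYOfRecord N θ.toStage3Params Mstar 𝔈) x).GD 2 U (𝔬12 x).blk (𝔬12 x).blkY (evY12 x) ((𝔬12 x).G U ∘ₗ (𝔬12 x).Dstar U) ∧
      CoRealizes ((opsYOfRecord N θ.toStage3Params Mstar 𝔈) x).G₁ 0 U (𝔬12 x).blk (𝔬12 x).blk (ev12 x) ((𝔬12 x).G1 U) ∧ CoRealizes ((opsYOfRecord N θ.toStage3Params Mstar 𝔈) x).G₁ 2 U (𝔬12 x).blk (𝔬12 x).blkY (evY12 x) ((𝔬12 x).G1 U ∘ₗ (𝔬12 x).Dstar U))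
    (hco12₁ : ∀ (x : MemberY θ.d₆ θ.ℓ₆ θ.hd' θ.hL' θ.b₀ θ.b₁ Mstar) (U : (bg9Y (Matrix (Fin N) (Fin N) ℂ) (specialUnitaryUnits (Fin N)) x).Cfg),
      CoRealizes ((opsYOfRecord N θ.toStage3Params Mstar 𝔈) x).GD 1 U (𝔬12 x).blkY (𝔬12 x).blk (ev12 x) ((𝔬12 x).D U ∘ₗ (𝔬12 x).G U) ∧ CoRealizes ((opsYOfRecord N θ.toStage3Params Mstar 𝔈) x).G₁ 1 U (𝔬12 x).blkY (𝔬12 x).blk (ev12 x) ((𝔬12 x).D U ∘ₗ (𝔬12 x).G1 U))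
    (hcoH12 : ∀ (x : MemberY θ.d₆ θ.ℓ₆ θ.hd' θ.hL' θ.b₀ θ.b₁ Mstar) (U : (bg9Y (Matrix (Fin N) (Fin N) ℂ) (specialUnitaryUnits (Fin N)) x).Cfg),
      CoRealizesH ((opsYOfRecord N θ.toStage3Params Mstar 𝔈) x).H 0 U (θ.d₆ + 1) (𝔬12 x).blk (𝔬12 x).blkZ ((𝔬12 x).Hm U) ∧ CoRealizesH ((opsYOfRecord N θ.toStage3Params Mstar 𝔈) x).H 1 U (θ.d₆ + 1) (𝔬12 x).blkY (𝔬12 x).blkZ ((𝔬12 x).D U ∘ₗ (𝔬12 x).Hm U) ∧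
      CoRealizesH ((opsYOfRecord N θ.toStage3Params Mstar 𝔈) x).H₁ 0 U (θ.d₆ + 1) (𝔬12 x).blk (𝔬12 x).blkZ ((𝔬12 x).H1m U) ∧ CoRealizesH ((opsYOfRecord N θ.toStage3Params Mstar 𝔈) x).H₁ 1 U (θ.d₆ + 1) (𝔬12 x).blkY (𝔬12 x).blkZ ((𝔬12 x).D U ∘ₗ (𝔬12 x).H1m U))
    (hcoG12 : ∀ (x : MemberY θ.d₆ θ.ℓ₆ θ.hd' θ.hL' θ.b₀ θ.b₁ Mstar) (U : (bg9Y (Matrix (Fin N) (Fin N) ℂ) (specialUnitaryUnits (Fin N)) x).Cfg),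
      CoReadsGlob ((opsYOfRecord N θ.toStage3Params Mstar 𝔈) x).GD 0 U (𝔬12 x).blk (𝔬12 x).blk (ev12 x) ((𝔬12 x).G U) ∧ CoReadsGlob ((opsYOfRecord N θ.toStage3Params Mstar 𝔈) x).GD 1 U (𝔬12 x).blkY (𝔬12 x).blk (ev12 x) ((𝔬12 x).D U ∘ₗ (𝔬12 x).G U) ∧
      CoReadsGlob ((opsYOfRecord N θ.toStage3Params Mstar 𝔈) x).GD 2 U (𝔬12 x).blk (𝔬12 x).blkY (evY12 x) ((𝔬12 x).G U ∘ₗ (𝔬12 x).Dstar U) ∧ CoReadsGlob ((opsYOfRecord N θ.toStage3Params Mstar 𝔈) x).G₁ 0 U (𝔬12 x).blk (𝔬12 x).blk (ev12 x) ((𝔬12 x).G1 U) ∧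
      CoReadsGlob ((opsYOfRecord N θ.toStage3Params Mstar 𝔈) x).G₁ 1 U (𝔬12 x).blkY (𝔬12 x).blk (ev12 x) ((𝔬12 x).D U ∘ₗ (𝔬12 x).G1 U) ∧ CoReadsGlob ((opsYOfRecord N θ.toStage3Params Mstar 𝔈) x).G₁ 2 U (𝔬12 x).blk (𝔬12 x).blkY (evY12 x) ((𝔬12 x).G1 U ∘ₗ (𝔬12 x).Dstar U))
    (hmodel12 : ∀ x : MemberY θ.d₆ θ.ℓ₆ θ.hd' θ.hL' θ.b₀ θ.b₁ Mstar, M12 ≤ (geo9Y x).M → ∀ α₀ : ℝ, 0 < α₀ → (geo9Y x).M * α₀ ≤ a12 →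
      ∀ U : (bg9Y (Matrix (Fin N) (Fin N) ℂ) (specialUnitaryUnits (Fin N)) x).Cfg, (bg9Y (Matrix (Fin N) (Fin N) ℂ) (specialUnitaryUnits (Fin N)) x).Reg335 c35Y α₀ U → (bg9Y (Matrix (Fin N) (Fin N) ℂ) (specialUnitaryUnits (Fin N)) x).Reg336 c35Y α₀ U →
        Thm33G0 (𝔬12 x) 1 (H12 x) B12₀ δ12₀ U ∧ B9Thm312Whole.Step (𝔬12 x) 1 (H12 x) (fun y => (geo9Y_len_pos x y).le) 1 (θ12 * ((geo9Y x).M * α₀)) δK12 U ∧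
        B9Thm312Whole.Step (𝔬12 x) 1 (H12 x) (fun y => (geo9Y_len_pos x y).le) 2 (θ12 * ((geo9Y x).M * α₀)) δK12 U ∧ FormSmall (𝔬12 x) (r12 * ((geo9Y x).M * α₀)) U ∧ B9Thm312Whole.Identities (𝔬12 x) U)
    (hleft12 : ∀ x : MemberY θ.d₆ θ.ℓ₆ θ.hd' θ.hL' θ.b₀ θ.b₁ Mstar, M12 ≤ (geo9Y x).M → ∀ α₀ : ℝ, 0 < α₀ → (geo9Y x).M * α₀ ≤ a12 →
      ∀ U : (bg9Y (Matrix (Fin N) (Fin N) ℂ) (specialUnitaryUnits (Fin N)) x).Cfg, (bg9Y (Matrix (Fin N) (Fin N) ℂ) (specialUnitaryUnits (Fin N)) x).Reg335 c35Y α₀ U → (bg9Y (Matrix (Fin N) (Fin N) ℂ) (specialUnitaryUnits (Fin N)) x).Reg336 c35Y α₀ U →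
        LeftStep (𝔬12 x) 1 (H12 x) (fun y => (geo9Y_len_pos x y).le) B12₀ δ12₀ (θD12 * ((geo9Y x).M * α₀)) δK12 U) (hlettersH12 : ∀ x : MemberY θ.d₆ θ.ℓ₆ θ.hd' θ.hL' θ.b₀ θ.b₁ Mstar, M12 ≤ (geo9Y x).M → ∀ α₀ : ℝ, 0 < α₀ → (geo9Y x).M * α₀ ≤ a12 →
      ∀ U : (bg9Y (Matrix (Fin N) (Fin N) ℂ) (specialUnitaryUnits (Fin N)) x).Cfg, (bg9Y (Matrix (Fin N) (Fin N) ℂ) (specialUnitaryUnits (Fin N)) x).Reg335 c35Y α₀ U → (bg9Y (Matrix (Fin N) (Fin N) ℂ) (specialUnitaryUnits (Fin N)) x).Reg336 c35Y α₀ U →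
        LettersH (𝔬12 x) 1 (H12 x) ⟨geo9Y_dist_triangle x, geo9Y_dist_comm x, geo9K_dist_nonneg x.toKIdx, geo9Y_len_pos x⟩ B12₃ δ12₃ U) (hres12 : ∀ x : MemberY θ.d₆ θ.ℓ₆ θ.hd' θ.hL' θ.b₀ θ.b₁ Mstar, M12 ≤ (geo9Y x).M → ∀ α₀ : ℝ, 0 < α₀ → (geo9Y x).M * α₀ ≤ a12 →
      ∀ U : (bg9Y (Matrix (Fin N) (Fin N) ℂ) (specialUnitaryUnits (Fin N)) x).Cfg, (bg9Y (Matrix (Fin N) (Fin N) ℂ) (specialUnitaryUnits (Fin N)) x).Reg335 c35Y α₀ U → (bg9Y (Matrix (Fin N) (Fin N) ℂ) (specialUnitaryUnits (Fin N)) x).Reg336 c35Y α₀ U →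
        (∀ K ∈ [((opsYOfRecord N θ.toStage3Params Mstar 𝔈) x).GD, ((opsYOfRecord N θ.toStage3Params Mstar 𝔈) x).G₁], L2Block K B12₁ δ12₁ U ∧ B9.Ineq343_345 K Bβ12 Bε12 Bεβ12 δ12₁ U) ∧
        (∀ Hk' ∈ [((opsYOfRecord N θ.toStage3Params Mstar 𝔈) x).H, ((opsYOfRecord N θ.toStage3Params Mstar 𝔈) x).H₁], ∀ (β : ℝ) (ζ : (geo9Y x).Cut) (y y' : (geo9Y x).Site), 0 ≤ β → β < 1 → (geo9Y x).cutInT ζ y →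
          Hk'.h U β ζ y' ≤ Bβ12 β * (geo9Y x).cutH β ζ * ((geo9Y x).len y) ^ (-(1 + β)) * ((geo9Y x).len y') ^ (-((θ.d₆ + 1 : ℕ) : ℝ)) * Real.exp (-(δ12₁ / 2 * (geo9Y x).dist y y'))))
    (hpinE : ∀ x : MemberY θ.d₆ θ.ℓ₆ θ.hd' θ.hL' θ.b₀ θ.b₁ Mstar, ((opsYOfRecord N θ.toStage3Params Mstar 𝔈) x).HasRWExp = HasRWExpOfOps (𝔬12 x)) (hpinH : ∀ x : MemberY θ.d₆ θ.ℓ₆ θ.hd' θ.hL' θ.b₀ θ.b₁ Mstar, ((opsYOfRecord N θ.toStage3Params Mstar 𝔈) x).HasRWExpH = HasRWExpHOfOps (𝔬12 x))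
    (hpinK : ∀ x : MemberY θ.d₆ θ.ℓ₆ θ.hd' θ.hL' θ.b₀ θ.b₁ Mstar, ((opsYOfRecord N θ.toStage3Params Mstar 𝔈) x).PosDefK = PosDefKOfOps (𝔬12 x)) (hco13 : ∀ (x : MemberY θ.d₆ θ.ℓ₆ θ.hd' θ.hL' θ.b₀ θ.b₁ Mstar) (U : (bg9Y (Matrix (Fin N) (Fin N) ℂ) (specialUnitaryUnits (Fin N)) x).Cfg),
      CoRealizes ((opsYOfRecord N θ.toStage3Params Mstar 𝔈) x).GG 0 U (𝔬12 x).blk (𝔬12 x).blk (ev12 x) ((𝔬12 x).GG U) ∧ CoRealizes ((opsYOfRecord N θ.toStage3Params Mstar 𝔈) x).GG 2 U (𝔬12 x).blk (𝔬12 x).blkY (evY12 x) ((𝔬12 x).GG U ∘ₗ (𝔬12 x).Dstar U))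
    (hco13₁ : ∀ (x : MemberY θ.d₆ θ.ℓ₆ θ.hd' θ.hL' θ.b₀ θ.b₁ Mstar) (U : (bg9Y (Matrix (Fin N) (Fin N) ℂ) (specialUnitaryUnits (Fin N)) x).Cfg), CoRealizes ((opsYOfRecord N θ.toStage3Params Mstar 𝔈) x).GG 1 U (𝔬12 x).blkY (𝔬12 x).blk (ev12 x) ((𝔬12 x).D U ∘ₗ (𝔬12 x).GG U))
    (hcoG13 : ∀ (x : MemberY θ.d₆ θ.ℓ₆ θ.hd' θ.hL' θ.b₀ θ.b₁ Mstar) (U : (bg9Y (Matrix (Fin N) (Fin N) ℂ) (specialUnitaryUnits (Fin N)) x).Cfg), CoReadsGlob ((opsYOfRecord N θ.toStage3Params Mstar 𝔈) x).GG 0 U (𝔬12 x).blk (𝔬12 x).blk (ev12 x) ((𝔬12 x).GG U) ∧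
      CoReadsGlob ((opsYOfRecord N θ.toStage3Params Mstar 𝔈) x).GG 1 U (𝔬12 x).blkY (𝔬12 x).blk (ev12 x) ((𝔬12 x).D U ∘ₗ (𝔬12 x).GG U) ∧ CoReadsGlob ((opsYOfRecord N θ.toStage3Params Mstar 𝔈) x).GG 2 U (𝔬12 x).blk (𝔬12 x).blkY (evY12 x) ((𝔬12 x).GG U ∘ₗ (𝔬12 x).Dstar U))
    (hletters13 : ∀ x : MemberY θ.d₆ θ.ℓ₆ θ.hd' θ.hL' θ.b₀ θ.b₁ Mstar, M12 ≤ (geo9Y x).M → ∀ α₀ : ℝ, 0 < α₀ → (geo9Y x).M * α₀ ≤ a12 →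
      ∀ U : (bg9Y (Matrix (Fin N) (Fin N) ℂ) (specialUnitaryUnits (Fin N)) x).Cfg, (bg9Y (Matrix (Fin N) (Fin N) ℂ) (specialUnitaryUnits (Fin N)) x).Reg335 c35Y α₀ U → (bg9Y (Matrix (Fin N) (Fin N) ℂ) (specialUnitaryUnits (Fin N)) x).Reg336 c35Y α₀ U →
        Letters313 (𝔬12 x) 1 (H12 x) ⟨geo9Y_dist_triangle x, geo9Y_dist_comm x, geo9K_dist_nonneg x.toKIdx, geo9Y_len_pos x⟩ B12₃ δ12₃ U) (hlettersD13 : ∀ x : MemberY θ.d₆ θ.ℓ₆ θ.hd' θ.hL' θ.b₀ θ.b₁ Mstar, M12 ≤ (geo9Y x).M → ∀ α₀ : ℝ, 0 < α₀ → (geo9Y x).M * α₀ ≤ a12 →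
      ∀ U : (bg9Y (Matrix (Fin N) (Fin N) ℂ) (specialUnitaryUnits (Fin N)) x).Cfg, (bg9Y (Matrix (Fin N) (Fin N) ℂ) (specialUnitaryUnits (Fin N)) x).Reg335 c35Y α₀ U → (bg9Y (Matrix (Fin N) (Fin N) ℂ) (specialUnitaryUnits (Fin N)) x).Reg336 c35Y α₀ U →
        Letters313D (𝔬12 x) 1 (H12 x) ⟨geo9Y_dist_triangle x, geo9Y_dist_comm x, geo9K_dist_nonneg x.toKIdx, geo9Y_len_pos x⟩ B12₃ δ12₃ (bH13 x) U) (hres13 : ∀ x : MemberY θ.d₆ θ.ℓ₆ θ.hd' θ.hL' θ.b₀ θ.b₁ Mstar, M12 ≤ (geo9Y x).M → ∀ α₀ : ℝ, 0 < α₀ → (geo9Y x).M * α₀ ≤ a12 →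
      ∀ U : (bg9Y (Matrix (Fin N) (Fin N) ℂ) (specialUnitaryUnits (Fin N)) x).Cfg, (bg9Y (Matrix (Fin N) (Fin N) ℂ) (specialUnitaryUnits (Fin N)) x).Reg335 c35Y α₀ U → (bg9Y (Matrix (Fin N) (Fin N) ℂ) (specialUnitaryUnits (Fin N)) x).Reg336 c35Y α₀ U →
        L2Block ((opsYOfRecord N θ.toStage3Params Mstar 𝔈) x).GG B12₁ δ12₁ U ∧ B9.Ineq343_345 ((opsYOfRecord N θ.toStage3Params Mstar 𝔈) x).GG Bβ12 Bε12 Bεβ12 δ12₁ U) (P : B12.RunParams)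
    : Dag.B9_main (leavesP w P) := by
  have hL1 : (1 : ℝ) ≤ ((θ.ℓ₆ + 1 : ℕ) : ℝ) := by exact_mod_cast Nat.succ_le_succ (Nat.zero_le _)
  have t311 := t311_of_pin θ.toStage3Params Mstar (opsYOfRecord N θ.toStage3Params Mstar 𝔈) 𝔬311 θ311 a311 M311 ha311 hM311 h311 hPD
  have t315 := t315_opsYOfRecord_of_slots N θ.toStage3Params Mstar 𝔈 hδ5 hG5 hH5
  have hGp := hGp_opsYOfLetters_of_leaves5 N θ.toStage3Params Mstar (lettersYOfRecord N θ.toStage3Params Mstar) 𝔈 hGpL3 hGpL4 hGpL5 hGpE4 hGpH2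
  have hGA := hGA_opsYOfLetters N θ.toStage3Params Mstar (lettersYOfRecord N θ.toStage3Params Mstar) 𝔈
  obtain ⟨t39, hksum⟩ := t39_hksum_of_pin_rowConst261BlkVia (opsYOfRecord N θ.toStage3Params Mstar 𝔈) 𝔬39 rd39 π39 (θ.d₆ + 1) α39 α' r39 δ39 θ39 B39 N39 a39 M39 cR39 c35Y_pos h39α h39α1
    hα'0 hα'1 hr39 hrδ39 hθ39 hB39 hN39 ha39 hM39 hcR39 hst39 hloc39 hπlen hπdist h39 hEK39 hrdC
  have s3132 := s3132_opsYOfRecord_vacuous (N := N) θ.toStage3Params Mstar 𝔈 (θ.d₆ + 1) c35Y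
  have hgeoOK : ∀ x : MemberY θ.d₆ θ.ℓ₆ θ.hd' θ.hL' θ.b₀ θ.b₁ Mstar, GeoOK (geo9Y x) := fun x => ⟨geo9Y_dist_triangle x, geo9Y_dist_comm x, geo9K_dist_nonneg x.toKIdx, geo9Y_len_pos x⟩
  obtain ⟨ML12, c12, hrow12⟩ := rowSum261_geo9Y (d := θ.d₆) (ℓ := θ.ℓ₆) (hd := θ.hd') (hL := θ.hL') (b₀ := θ.b₀) (b₁ := θ.b₁) (Mstar := Mstar) σ12 hσ12
  have hrow : ∀ x : MemberY θ.d₆ θ.ℓ₆ θ.hd' θ.hL' θ.b₀ θ.b₁ Mstar, ML12 ≤ (geo9Y x).M → RowSum (toB6 (geo9Y x) 1 (H12 x)) σ12 (max c12 0) := fun x hM y => (hrow12 x hM y).trans (le_max_left _ _)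
  have hE : (fun x => ((opsYOfRecord N θ.toStage3Params Mstar 𝔈) x).HasRWExp) = fun x => HasRWExpOfOps (𝔬12 x) := funext hpinE
  have hH : (fun x => ((opsYOfRecord N θ.toStage3Params Mstar 𝔈) x).HasRWExpH) = fun x => HasRWExpHOfOps (𝔬12 x) := funext hpinH
  have hK' : (fun x => ((opsYOfRecord N θ.toStage3Params Mstar 𝔈) x).PosDefK) = fun x => PosDefKOfOps (𝔬12 x) := funext hpinK
  have hη : ∀ x : MemberY θ.d₆ θ.ℓ₆ θ.hd' θ.hL' θ.b₀ θ.b₁ Mstar, 0 < (geo9Y x).eta := fun x => (distOK_geo9Y x).eta_pos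
  have hL21 := lemma21AboveG_geo9Y (d := θ.d₆) (ℓ := θ.ℓ₆) (hd := θ.hd') (hL := θ.hL') (b₀ := θ.b₀) (b₁ := θ.b₁) (Mstar := Mstar) H12 hα12 (hα12'.trans_lt one_half_lt_one)
  have t312 : B9.Thm312Printed (θ.d₆ + 1) c35Y geo9Y (bg9Y (Matrix (Fin N) (Fin N) ℂ) (specialUnitaryUnits (Fin N))) (fun x => ((opsYOfRecord N θ.toStage3Params Mstar 𝔈) x).GD) (fun x => ((opsYOfRecord N θ.toStage3Params Mstar 𝔈) x).G₁)
      (fun x => ((opsYOfRecord N θ.toStage3Params Mstar 𝔈) x).H) (fun x => ((opsYOfRecord N θ.toStage3Params Mstar 𝔈) x).H₁) (fun x => ((opsYOfRecord N θ.toStage3Params Mstar 𝔈) x).HasRWExp) (fun x => ((opsYOfRecord N θ.toStage3Params Mstar 𝔈) x).HasRWExpH)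
      (fun x => ((opsYOfRecord N θ.toStage3Params Mstar 𝔈) x).PosDefK) := by
    rw [hE, hH, hK']
    exact thm312Printed_of_stepDHG 𝔬12 (fun _ => 1) H12 (fun x => ((opsYOfRecord N θ.toStage3Params Mstar 𝔈) x).GD) (fun x => ((opsYOfRecord N θ.toStage3Params Mstar 𝔈) x).G₁) (fun x => ((opsYOfRecord N θ.toStage3Params Mstar 𝔈) x).H)
      (fun x => ((opsYOfRecord N θ.toStage3Params Mstar 𝔈) x).H₁) ev12 evY12 θ12 θD12 r12 B12₀ δ12₀ δK12 σ12 (max c12 0) ρ12 a12 M12 ML12 B12₁ δ12₁ B12₃ δ12₃ α12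
      ((θ.ℓ₆ + 1 : ℕ) : ℝ) Bβ12 Bε12 Bεβ12 hθ12 hθD12 hr12 hB12₀ hB12₃ hσ12.le hρ12 hρS12 hρδ12 hρ₃12 (le_max_right _ _) ha12 hM12 hδ12₁ hα12' hBβ12 hBε12 hBεβ12 hgeoOK
      (fun x => modelSignsOn_geo9K x.toKIdx) (fun _ => hL1) (fun _ => le_rfl) hη hrow hL21 hco12 hco12₁ hcoH12 hcoG12 hmodel12 hleft12 hlettersH12 hres12
  have t313 : B9.Thm313Printed c35Y geo9Y (bg9Y (Matrix (Fin N) (Fin N) ℂ) (specialUnitaryUnits (Fin N))) (fun x => ((opsYOfRecord N θ.toStage3Params Mstar 𝔈) x).GG) (fun x => ((opsYOfRecord N θ.toStage3Params Mstar 𝔈) x).HasRWExp) (fun x => ((opsYOfRecord N θ.toStage3Params Mstar 𝔈) x).PosDefK) := by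
    rw [hE, hK']
    exact thm313Printed_of_stepDG 𝔬12 (fun _ => 1) H12 (fun x => ((opsYOfRecord N θ.toStage3Params Mstar 𝔈) x).GG) bH13 ev12 evY12 θ12 θD12 r12 B12₀ δ12₀ δK12 σ12 (max c12 0) ρ12 a12 M12 ML12
      B12₁ δ12₁ B12₃ δ12₃ ρ13 α12 ((θ.ℓ₆ + 1 : ℕ) : ℝ) κ13 Bβ12 Bε12 Bεβ12 hθ12 hθD12 hr12 hB12₀ hB12₃ hσ12.le hρ13 hρ13ρ hρS12 (le_trans (by linarith only [hσ12]) hρ₃12) hρδ12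
      (le_max_right _ _) ha12 hM12 hδ12₁ hBβ12 hBε12 hBεβ12 hgeoOK (fun x => modelSignsOn_geo9K x.toKIdx) (fun _ => hL1) (fun _ => le_rfl) hη hκ13 hrow hL21 hco13 hco13₁ hcoG13
      hmodel12 hleft12 hletters13 hlettersD13 hres13
  have hE4 := hE4_of_hGA_e4 (opsYOfRecord N θ.toStage3Params Mstar 𝔈) (hGA_e4_opsYOfLetters N θ.toStage3Params Mstar (lettersYOfRecord N θ.toStage3Params Mstar) 𝔈)
  have hH2 := hH2_of_hGA_h2 (opsYOfRecord N θ.toStage3Params Mstar 𝔈) (hGA_h2_opsYOfLetters N θ.toStage3Params Mstar (lettersYOfRecord N θ.toStage3Params Mstar) 𝔈)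
  have hg := hg_obligation_vacuous θ.toStage3Params Mstar (opsYOfRecord N θ.toStage3Params Mstar 𝔈)
  obtain ⟨t37', c38', t310', hsum'⟩ := rows131819_definite_geo9Y (bg := bg9Y (Matrix (Fin N) (Fin N) ℂ) (specialUnitaryUnits (Fin N))) p q hp hq c35Y_pos H 𝔬 rd 𝔭 bH (fun x => ((opsYOfRecord N θ.toStage3Params Mstar 𝔈) x).Gp) (fun x => (rd x).ev) evY κ SH SL SI S2
    hst hκ hrd hloc h36 h36H hco0 hco1 hco2 hco3 hgl0 hgl1 hgl2 hgl3 hl0 hl1 hl2 hl3 hl4 hl5 hH1 hIR hsym htr hadjL hcntH hcntL hcntI hcnt2 𝔬310 rd310 𝔭3 bH3 (fun x => ((opsYOfRecord N θ.toStage3Params Mstar 𝔈) x).GA) ev3 evY3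
    κ310 SH3 SL3 SI3 S23 hst3 hκ3 hrd3 hloc3 h36_3 h36H3 hcoA0 hcoA1 hcoA2 hcoA3 hglA0 hglA1 hglA2 hglA3 hlA0 hlA1 hlA2 hlA3 hlA4 hlA5 hH13 hIR3 hsymA htrA hadjLA hcntH3 hcntL3 hcntI3 hcnt23
  have h37f : (fun x => ((opsYOfRecord N θ.toStage3Params Mstar 𝔈) x).E37) = fun x => E37Y (bg := bg9Y (Matrix (Fin N) (Fin N) ℂ) (specialUnitaryUnits (Fin N))) p q (𝔬 x) (rd x) (H x) ((opsYOfRecord N θ.toStage3Params Mstar 𝔈) x).Gp := funext hE37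
  have h310f : (fun x => ((opsYOfRecord N θ.toStage3Params Mstar 𝔈) x).E310) = fun x => E310Y (bg := bg9Y (Matrix (Fin N) (Fin N) ℂ) (specialUnitaryUnits (Fin N))) p q (𝔬310 x) (rd310 x) (H x) ((opsYOfRecord N θ.toStage3Params Mstar 𝔈) x).GA := funext hE310
  have t37 : B9.Thm37Printed c35Y geo9Y (bg9Y (Matrix (Fin N) (Fin N) ℂ) (specialUnitaryUnits (Fin N))) (fun x => ((opsYOfRecord N θ.toStage3Params Mstar 𝔈) x).E37) := h37f ▸ t37'
  have c38 : B9.Cor38Printed c35Y geo9Y (bg9Y (Matrix (Fin N) (Fin N) ℂ) (specialUnitaryUnits (Fin N))) (fun x => ((opsYOfRecord N θ.toStage3Params Mstar 𝔈) x).E37) := h37f ▸ c38'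
  have t310 : B9.Thm310Printed c35Y geo9Y (bg9Y (Matrix (Fin N) (Fin N) ℂ) (specialUnitaryUnits (Fin N))) (fun x => ((opsYOfRecord N θ.toStage3Params Mstar 𝔈) x).E310) := h310f ▸ t310'
  have hsum : B9.RWSumsYieldIneqs geo9Y (bg9Y (Matrix (Fin N) (Fin N) ℂ) (specialUnitaryUnits (Fin N))) (fun x => ((opsYOfRecord N θ.toStage3Params Mstar 𝔈) x).E37) (fun x => ((opsYOfRecord N θ.toStage3Params Mstar 𝔈) x).E310) (fun x => ((opsYOfRecord N θ.toStage3Params Mstar 𝔈) x).Gp) (fun x => ((opsYOfRecord N θ.toStage3Params Mstar 𝔈) x).GA) := by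
    rw [h37f, h310f]; exact hsum'
  have t314 := t314_opsYOfRecord_vacuous N θ.toStage3Params Mstar 𝔈
  have t314loc := t314loc_opsYOfRecord_vacuous N θ.toStage3Params Mstar 𝔈
  have h32 := B9.thm32_of_thm39 (θ.d₆ + 1) c35Y geo9Y (bg9Y (Matrix (Fin N) (Fin N) ℂ) (specialUnitaryUnits (Fin N))) (fun x => ((opsYOfRecord N θ.toStage3Params Mstar 𝔈) x).EK39) (fun x => ((opsYOfRecord N θ.toStage3Params Mstar 𝔈) x).Cinv) t39 hksum
  have h33 := B9.thm33_of_thm37_310 c35Y geo9Y (bg9Y (Matrix (Fin N) (Fin N) ℂ) (specialUnitaryUnits (Fin N))) (fun x => ((opsYOfRecord N θ.toStage3Params Mstar 𝔈) x).E37) (fun x => ((opsYOfRecord N θ.toStage3Params Mstar 𝔈) x).E310) (fun x => ((opsYOfRecord N θ.toStage3Params Mstar 𝔈) x).Gp)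
    (fun x => ((opsYOfRecord N θ.toStage3Params Mstar 𝔈) x).GA) t37 t310 hsum
  have hB := hB_obligation_of_sectBFrame θ.toStage3Params Mstar (opsYOfRecord N θ.toStage3Params Mstar 𝔈) bB SB F hdB h32 h33
  have s349 := s349_opsYOfRecord_vacuous (N := N) θ.toStage3Params Mstar 𝔈 (θ.d₆ + 1) c35Y
  exact b9_main_of_up_view₁₁B10YZW_of_obligations θ hθ Mstar (opsYOfRecord N θ.toStage3Params Mstar 𝔈) ζ lamW w hup (hGp_e_opsYOfLetters N θ.toStage3Params Mstar (lettersYOfRecord N θ.toStage3Params Mstar) 𝔈) (hGp_h1_opsYOfLetters N θ.toStage3Params Mstar (lettersYOfRecord N θ.toStage3Params Mstar) 𝔈)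
    (hC_opsYOfLetters N θ.toStage3Params Mstar (lettersYOfRecord N θ.toStage3Params Mstar) 𝔈) (hGA_e_opsYOfLetters N θ.toStage3Params Mstar (lettersYOfRecord N θ.toStage3Params Mstar) 𝔈) (hGA_h1_opsYOfLetters N θ.toStage3Params Mstar (lettersYOfRecord N θ.toStage3Params Mstar) 𝔈) (hGA_e4_opsYOfLetters N θ.toStage3Params Mstar (lettersYOfRecord N θ.toStage3Params Mstar) 𝔈)
    (hGA_h2_opsYOfLetters N θ.toStage3Params Mstar (lettersYOfRecord N θ.toStage3Params Mstar) 𝔈) (hGA_l2_opsYOfLetters N θ.toStage3Params Mstar (lettersYOfRecord N θ.toStage3Params Mstar) 𝔈) hE4 hH2 hGp hGA hB hg t37 c38 t39 t310 hsum hksum t311 t312 t313 t314 t315 s349 s3132 t314loc P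

end Pointed

end Summit.QuantumFields.YangMills.BalabanUVNodes.N06AtOpsYOfRecordB

end
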